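import Summits.QuantumFields.QCD.Theorems.HeatSlicedQuarksInterleavedFlowProperStubDiagonalExtraction
import Summits.QuantumFields.QCD.Theorems.RobustYangMillsHandover.Negative.GapClauses

/-!
# Crux `InterleavedFlowProper` (stmt-QuantumFields-18031), line `Sketch` gen 4 — anatomy of the KΩ′ target

The gen-4 reshape of the continuum package typed a NEW intermediate target, `LocallyUniformQCDLimits` (limits of X₀'s
periodic-quark lattice Schwinger functions locally uniformly in the mass tuple, from every subsequence).  This file certifies
that the new target is EXACTLY the route target X₀ = `ContinuumQCDExists`:

* `locallyUniformQCDLimits_of_continuumQCDExists` — X₀ delivers the package trivially (`φ = id` from every `ψ`, `M₀ = 0`);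
* `locallyUniformQCDLimits_iff_continuumQCDExists` — together with the registered stub `limitsAlong_of_locallyUniform`, the
  landing pad `thresholdContinuumQCDExists_of_limitsAlong` and the tree's `continuumQCDExists_iff_threshold`.

So the reshape neither weakened the line nor typed a junk-inhabited (cf. finding F5 on `FiniteRangeHeatSlices`) or
over-strong (false) stub target: KΩ′ `stub_locallyUniformLimits` is X₀-hard exactly as KΩ was, and its difference from KΩ is
the logical step K4, now landed.
-/

noncomputable section

namespace Summit.QuantumFields.QCD.Cruxes.InterleavedFlowProper.OffsetLastFormatHandover

open Summit.QuantumFields.QCD.Theses.HeatSlicedQuarks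
open Literature.MathematicalPhysics.QuantumFieldTheory Literature.MathematicalPhysics.QuantumLattice
  Literature.MathematicalPhysics.AQFT
open Filter Topology MeasureTheory

/-- **X₀ delivers the locally-uniform package trivially**: along the full sequence every tuple converges, so from every
`ψ` the extraction `φ = id` serves every box (offset `M₀ = 0`, radius `ε = 1`); asymptotic scaling of `reg.scheme 0 0 0`
is that of any `reg.scheme m z shift` (the clause reads `β_k, a_k` only). [folklore] -/
theorem locallyUniformQCDLimits_of_continuumQCDExists (hX : ContinuumQCDExists) : LocallyUniformQCDLimits := by
  intro Nf hNf
  obtain ⟨reg, hms, hall⟩ := hX Nf hNf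
  have has : (reg.scheme 0 0 0).HasAsymptoticScaling := by
    obtain ⟨z, shift, T, hqcd, -⟩ := hall (fun _ => 1) (fun _ => one_pos)
    obtain ⟨Λ, hΛ, ht⟩ := hqcd.1
    exact ⟨Λ, hΛ, ht⟩
  refine ⟨0, le_rfl, reg, hms, has, fun m₀ _ => ⟨1, one_pos, fun ψ hψ => ⟨id, strictMono_id, fun m hm _ => ?_⟩⟩⟩
  obtain ⟨z, shift, T, ⟨-, hbr, hconv⟩, hN, hG, hP⟩ := hall m hm
  exact ⟨hbr, z, shift, T, fun n hn σ f F hF hoff => (hconv n hn σ f F hF hoff).comp hψ.tendsto_atTop, hN, hG, hP⟩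

/-- **The gen-4 KΩ′ target is ≡ X₀**: `LocallyUniformQCDLimits ↔ ContinuumQCDExists` — forward through the registered
stub `limitsAlong_of_locallyUniform`, the landed landing pad `thresholdContinuumQCDExists_of_limitsAlong` and the tree's
`continuumQCDExists_iff_threshold` (X₀ is offset-blind); backward by `locallyUniformQCDLimits_of_continuumQCDExists`.
So the reshape neither weakened the line (KΩ′ still concludes X₀ through the composition) nor typed a junk-inhabited or
false target. [folklore] -/
theorem locallyUniformQCDLimits_iff_continuumQCDExists : LocallyUniformQCDLimits ↔ ContinuumQCDExists :=
  ⟨fun h => Theorems.RobustYangMillsHandover.Negative.continuumQCDExists_iff_threshold.mpr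
      (thresholdContinuumQCDExists_of_limitsAlong (limitsAlong_of_locallyUniform h)),
    locallyUniformQCDLimits_of_continuumQCDExists⟩

end Summit.QuantumFields.QCD.Cruxes.InterleavedFlowProper.OffsetLastFormatHandover

end
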